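import Mathlib
import HarnessLib
import HarnessLib.Audit
import Summits.KontsevichZagierPeriods.Statement
import Literature.NumberTheory.Transcendental.KZProduct
import Literature.NumberTheory.Transcendental.MZVSimplexRep
import HarnessLib.Audit.Status.Attr

/-!
Route: PeriodConductors

# Route PeriodConductors — conductors of periods — π is ramified at 2, π² is not; Conjecture 1 over
Spec ℤ on the regular-matroid sector, ConductorBound mod Ψ, cuts are S-units

Card conductors-of-periods-spec-z-calculus (spine): every KZ datum has a model over ℤ, hence a
CONDUCTOR (primes of bad reduction of
walls ∪ poles ∪ ∞), and Conjecture 1 can be read prime by prime. The typable layer today is the part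
of the conductor that is
elementary: points on ℙ¹_ℤ (separable reduction, no degree drop) for one-dimensional
representations, and matroid reduction
(rank of every row set of the primitive integer normal vectors, hyperplane at infinity included,
equal over 𝔽_p and ℚ) for
representations over linear cells with linear poles. It suffices to show X = UnimodularKernel ∧
RamifiedReduction:
UnimodularKernel = "Conjecture 1 over Spec ℤ" on the everywhere-good (regular-matroid) linear sector
— every vanishing
ℤ-combination of such representations is a KZ relation; RamifiedReduction = the honest complement
(every vanishing formal
combination is KZ-congruent to a vanishing one in that sector; Conjecture 1 off the sector, owned by
all routes). X ⟺ Conjecture 1.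
The ENGINE the card adds rides beside the cores: PiRamifiedAtTwo (rules-level "π is ramified at 2":
no multiple of [disc] is
KZ-congruent to the ring generated by 2-good curve and 2-good linear representations — a separation
invisible to Hodge theory,
provable from Ψ + heredity of good reduction), UnimodularValuesAreMZV ("the unramified world is
Brown's"), TwoGoodDimOne (the
Baker rung), and the S-unit facts NoCutOverZ / RationalTwoCuts (over ℤ there is nowhere to cut; over
ℤ[1/2] only at 1/2).
Lean: `(let lin : (n : ℕ) → (k : ℕ) → (Fin k → Fin (n + 1) → ℤ) → Fin k → (Fin n → ℝ) → ℝ := fun n _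
M i x => (M i 0 : ℝ) + ∑ j : Fin n, (M i j.succ : ℝ) * x j; let good : (n : ℕ) → (k : ℕ) → ℕ → (Fin
k → Fin (n + 1) → ℤ) → Prop := fun n k p M => ∀ T : Finset (Fin k), (Matrix.of fun (i : T) (j : Fin
(n + 1)) => (M i j : ZMod p)).rank = (Matrix.of fun (i : T) (j : Fin (n + 1)) => (M i j : ℚ)).rank;
let cell : Finset ℕ → Set Literature.NumberTheory.Transcendental.KZ.FormalRep := fun S => {x | ∃ (n
k : ℕ) (M : Fin k → Fin (n + 1) → ℤ) (w : Fin k → Bool) (m : Fin k → ℕ) (P : MvPolynomial (Fin n) ℚ)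
(r : Literature.NumberTheory.Transcendental.KZ.IntegralRep n), (∃ i, M i = Pi.single 0 1) ∧ (∀ p :
ℕ, p.Prime → p ∉ S → good n k p M) ∧ r.domain = {x | ∀ i, w i = true → 0 < lin n k M i x} ∧ Set.EqOn
r.integrand (fun x => MvPolynomial.aeval x P / ∏ i, lin n k M i x ^ m i) r.domain ∧ x =
Literature.NumberTheory.Transcendental.KZ.of r}; ∀ c ∈ AddSubgroup.closure (cell ∅),
Literature.NumberTheory.Transcendental.KZ.eval c = 0 → c ∈
Literature.NumberTheory.Transcendental.KZ.relations) ∧ (let lin : (n : ℕ) → (k : ℕ) → (Fin k → Fin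
(n + 1) → ℤ) → Fin k → (Fin n → ℝ) → ℝ := fun n _ M i x => (M i 0 : ℝ) + ∑ j : Fin n, (M i j.succ :
ℝ) * x j; let good : (n : ℕ) → (k : ℕ) → ℕ → (Fin k → Fin (n + 1) → ℤ) → Prop := fun n k p M => ∀ T
: Finset (Fin k), (Matrix.of fun (i : T) (j : Fin (n + 1)) => (M i j : ZMod p)).rank = (Matrix.of
fun (i : T) (j : Fin (n + 1)) => (M i j : ℚ)).rank; let cell : Finset ℕ → Set
Literature.NumberTheory.Transcendental.KZ.FormalRep := fun S => {x | ∃ (n k : ℕ) (M : Fin k → Fin (n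
+ 1) → ℤ) (w : Fin k → Bool) (m : Fin k → ℕ) (P : MvPolynomial (Fin n) ℚ) (r :
Literature.NumberTheory.Transcendental.KZ.IntegralRep n), (∃ i, M i = Pi.single 0 1) ∧ (∀ p : ℕ,
p.Prime → p ∉ S → good n k p M) ∧ r.domain = {x | ∀ i, w i = true → 0 < lin n k M i x} ∧ Set.EqOn
r.integrand (fun x => MvPolynomial.aeval x P / ∏ i, lin n k M i x ^ m i) r.domain ∧ x =
Literature.NumberTheory.Transcendental.KZ.of r}; ∀ c :
Literature.NumberTheory.Transcendental.KZ.FormalRep, Literature.NumberTheory.Transcendental.KZ.eval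
c = 0 → ∃ c' ∈ AddSubgroup.closure (cell ∅), Literature.NumberTheory.Transcendental.KZ.eval c' = 0 ∧
c - c' ∈ Literature.NumberTheory.Transcendental.KZ.relations)`

## Assembly
Pure logic — the DECIDING THEOREM `closes : UnimodularKernel → RamifiedReduction →
KontsevichZagierPeriods` (filed rev 2, sorry-free,
10 lines, axioms propext/Classical.choice/Quot.sound; the item Assembly has exactly this type since
rev 3): for rational r, r' with equal
values put c = [r] − [r'], so KZ.eval c = 0; RamifiedReduction gives c' in the ℤ-span of
everywhere-good linear cells with
KZ.eval c' = 0 and c − c' ∈ KZ.relations; UnimodularKernel gives c' ∈ KZ.relations; relations is a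
subgroup, so c ∈ KZ.relations, i.e.
KZ.Equivalent r r'. (The kernel→summit step — formerly the shared support KernelImpliesStatement,
stmt-KontsevichZagierPeriods-0197 — is
inlined in `closes` and is no longer an item of this route; rev 3 also inlines Baker's theorem into
TwoGoodDimOne so that the route
imports no PeriodsWave0 named fact: the dependency cone carries 0 unproved facts.)

Rationale: WHY THIS LINE. Kontsevich–Zagier data are ℚ-semialgebraic, so after clearing denominators they have
integral models, and the ℓ-adic realisation
of the pair motive Hⁿ(X_r, D_r) (HuberMullerStachPeriods2017 Thm 12.2.1) is unramified at p whenever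
the model has good reduction
at p; good reduction is inherited by subquotients and tensor constructions, and the motives
unramified outside S form full
Tannakian subcategories (DeligneGoncharov2005 §1, arXiv:math/0302267; Brown2012 = arXiv:1102.1312:
effective real periods of MT(ℤ)
are exactly the MZVs). Composing with Ψ ("moves are motivic", the shared unbuilt map of routes
HodgeColevel/CoactionDevissage)
gives a third lower bound on representations next to dimension (HodgeColevel) and level
(HodgeLevel): the conductor — the first
invariant in the tree that separates the Gauss disc [x²+y²<1] (motive ℚ(−1)⊗χ₋₄, conductor 4) from
Eisenstein-type periods
2π/√3 = ∫_ℝ dx/(x²+x+1) (ℚ(−1)⊗χ₋₃, unramified at 2) although their Hodge numbers coincide. On the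
positive side the
arithmetic of ℙ¹∖{0,1,∞} over ℤ (unit equation: no solutions over ℤ, Hermite–Minkowski; finitely
many per degree over ℤ[1/S],
Evertse–Győry doi:10.1017/cbo9781316160749) explains why every MZV proof never leaves MZV-land —
over ℤ there is nowhere to cut —
and defines the unramified sector ARITHMETICALLY (regular matroids, all dimensions) rather than by
shape (simplices: CoactionDevissage;
cells: ScissorsAvatars). Imported: integral models / ramification of ℓ-adic realisations and
Tannakian heredity (arithmetic geometry),
S-unit equations (Diophantine approximation), matroid reduction (combinatorics), Baker's theorem in
dimension 1; no analytic or
probabilistic reformulation — the point is that no period is evaluated except in the d = 1 rung.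
Negatives index empty; nothing to avoid.

RANKED CRUXES. #0 Target (target) — X = UnimodularKernel ∧ RamifiedReduction (§ Thesis): Conjecture
1 over Spec ℤ on the regular-matroid linear sector, and the reduction of every vanishing formal
combination to that sector. (why it might fail: X ⟺ Conjecture 1 (RamifiedReduction ⇐ summit with c'
= 0; UnimodularKernel ⇐ kernel form): every strength barrier of the summit applies to X as a whole;
the arithmetic split only relocates difficulty by conductor.) [KontsevichZagierPeriods2001,
HuberMullerStachPeriods2017, Brown2012]
#2 PiRamifiedAtTwo (crux) — rules-level "π is ramified at 2" (card (O2)/(O3), typable fragment of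
NoUnramifiedPi): for every N ≠ 0 and every c in the (non-unital) subring of KZ.FormalRep generated
by (a) one-dimensional representations of KZ-rational shape whose divisor (boundary points ∪ complex
poles ∪ ∞ ⊂ ℙ¹) is étale at 2 — witnessed by an integer polynomial G ≠ 0 vanishing on boundary
points and poles with G mod 2 separable of the same degree — and (b) representations over open
linear cells with linear poles whose matroid (primitive rows incl. the hyperplane at infinity) has
the same ranks over 𝔽₂ as over ℚ, the element N•[KZ.piRep] − c is NOT a KZ relation. Route to a
proof: Ψ sends c into the coefficient space of U₂ = Nori motives unramified at 2 (Tannakian, closed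
under subquotients), while Ψ[piRep] spans C(H¹(norm-one torus)) = C(ℚ(−1)⊗χ₋₄), and C(N) ⊆ C(U₂)
forces N ∈ U₂ — but χ₋₄ is ramified at 2. The family contains 2π/√3 = [ℝ, 1/(x²+x+1)], log 3 =
[(0,1), (2x+1)/(x²+x+1)], Li-values at 1/3, all MZV cells, golden-ratio-field algebraic lengths;
single instances with known values are provable now by soundness (Nπ ≠ 2Mπ/√3). [difficulty: XL]
(why it might fail: Rides on the unbuilt Ψ and on '2-good point/matroid data ⇒ pair motive
unramified at 2' (for bi-arrangements with poles on cell faces the blow-ups must stay good over ℤ₍₂₎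
— unprinted); the value shadow 'Nπ ∉ ring of 2-good curve/linear periods' is GPC-strength, so no
Ψ-free proof exists.) [KontsevichZagierPeriods2001, HuberMullerStachPeriods2017,
DeligneGoncharov2005, arXiv:1410.6348, arXiv:1102.1312]
#3 UnimodularKernel (crux) — "Conjecture 1 over Spec ℤ" on the regular-matroid linear sector (card
(C1)/(C2) at S = ∅, plain-relations form): every ℤ-combination c of representations [r], r over an
open rational linear cell {ℓ_i > 0} with integrand P(x)/∏ ℓ_i(x)^(m_i) (P ∈ ℚ[x], ℓ_i integral
affine forms, one row the hyperplane at infinity) whose matroid has the same ranks over every 𝔽_p as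
over ℚ, with KZ.eval c = 0, lies in KZ.relations. By UnimodularValuesAreMZV its value content is the
ℚ-relations among MZVs presented by regular cells (all dimensions, all polytopes — graphic,
cographic and sporadic regular matroids), i.e. CoactionDevissage's MZV sector PLUS the accessibility
'every regular cell is KZ-congruent to simplex combinations'. [deps: UnimodularValuesAreMZV]
[difficulty: open-problem] (why it might fail: Conjecture-1 strength on the sector: contains all
ℚ-relations among MZV-valued cells incl. non-graphic regular matroids (R₁₀, cographic K₃₃) where
Fubini leaves the linear world (no linear reducibility), plus every regularised double-shuffle
consequence with convergent intermediates.) [KontsevichZagierPeriods2001, Brown2012,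
arXiv:math/0606419, arXiv:1410.6348, HuberMullerStachPeriods2017]
#4 UnimodularValuesAreMZV (crux) — the unramified linear world is Brown's (card (C2) at S = ∅, value
level): the value of every representation over an open rational linear cell with linear poles whose
matroid (incl. the hyperplane at infinity) has good reduction at EVERY prime lies in the ℚ-span of
the multiple zeta values (⨆_w mzvSpace w). Chain: matroid good at all p ⇒ motive of the
bi-arrangement pair mixed Tate (Dupont) and unramified everywhere ⇒ in MT(ℤ) (Deligne–Goncharov) ⇒
effective real-Frobenius-invariant period ⇒ MZV (Brown 2012). Calibrations done here: ζ(2)-cell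
regular ✓; [(0,1)², 1/(x+y)] = 2 log 2 is flagged (rows x=1, y=1, x+y=0 have determinant 2);
[(0,1)³, 1/(x+y+z−1)] flagged (determinant ±2); in dimension 1 only ∫_a^(a+1) P dx ∈ ℚ survive.
[difficulty: XL] (why it might fail: 'Matroid good at p ⇒ motive unramified at p' is printed for
arrangement complements, not for BI-arrangements with poles on cell faces (Dupont's blow-ups add
exceptional divisors whose reduction is unchecked); one regular cell integrating to a certified
non-MZV (a log 2) kills it.) [Brown2012, arXiv:1102.1312, DeligneGoncharov2005, arXiv:math/0302267,
arXiv:1410.6348, arXiv:math/0606419]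
#5 TwoGoodDimOne (crux) — the d = 1 rung of NoUnramifiedPi at VALUE level, from Baker (card (O2),
unconditional in dimension 1 modulo Baker): assuming Baker's theorem — stated verbatim as the
antecedent (the body of the tree's named fact `baker` at universe 0; inlined at rev 3, `Iff.rfl`
with the rev-1 decl, so that the route imports no PeriodsWave0 fact) — a one-dimensional
representation of KZ-rational shape whose divisor (boundary points ∪ poles ∪ ∞) is étale at 2 never
has value in ℚ^×·π. Paper proof (this route): value = α + Σ β_j Log γ_j with α, β_j, γ_j in K =
ℚ(divisor); value = sπ, s ∈ ℚ^× forces, by Baker and torsion bookkeeping, i·s ∈ K, i.e. i ∈ K; but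
each ℚ(θ), θ in the divisor, is unramified at 2, hence so is K — contradiction. Examples:
4∫₀¹dx/(1+x²) (pole i ≡ 1 mod 1+i), ∫_ℝ dx/(1+x²) (i ≡ −i), every Machin arctangent: all 2-bad; ∫_ℝ
dx/(x²+x+1) = 2π/√3 is 2-good and indeed ∉ ℚ^×π. [difficulty: L] (why it might fail: True on paper
via Baker; risks are the encoding (isolated boundary points, removable poles, unbounded pieces, ∞
always a wall) and the Lean cost of 'dim-1 values are ℚ̄-linear forms in logs' + branch/torsion
bookkeeping (LowDimension 0405 machinery, unbuilt).) [Baker1966, Baker1975, HuberWustholz2022,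
KontsevichZagierPeriods2001]
#9 RamifiedReduction (support) — the honest complement of the sector (Conjecture 1 off the
unramified linear sector): every formal combination c with KZ.eval c = 0 is KZ-congruent to some
vanishing c' in the ℤ-span of everywhere-good linear-cell representations (under Conjecture 1 take
c' = 0). Summit-strength, not this route's bet, not staffed. [difficulty: open-problem]
[KontsevichZagierPeriods2001, HuberMullerStachPeriods2017]
(dropped at rev 3: #9 KernelImpliesStatement — the shared last step
stmt-KontsevichZagierPeriods-0197, KZKernelConjecture → summit, an item of this route at revs 1–2 —
because the deciding theorem `closes` inlines that step; the item stays wanted by its other routes.)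
#9 EulerBasel (support) — π² descends to conductor ∅ although π does not (card (O2), positive side;
SHARED with CoactionDevissage stmt-KontsevichZagierPeriods-3168): 6•[ζ(2)-simplex] − [disc]·[disc] ∈
KZ.relations — the ζ(2) simplex is everywhere good (M_{0,5} arrangement), [disc] has conductor {2}
(x²+y²−1 ≡ (x+y+1)² mod 2). Conjecture-1 instance; KZ2001 §1.2 sketch the chain. [difficulty: M]
[KontsevichZagierPeriods2001, stmt-KontsevichZagierPeriods-3168, Brown2012]
#9 NoCutOverZ (support) — over Spec ℤ there is nowhere to cut (card (O1), all algebraic cut points):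
if c and 1 − c are both units of the ring of integers of a number field K then |disc K| > 2 (so K ≠
ℚ and some prime ramifies: an admissible cut of KZ_∅ on a {0,1}-walled axis does not exist, rational
or algebraic). Mathlib: NumberField.abs_discr_gt_two + units of ℤ are ±1. [difficulty: provable-now]
[doi:10.1017/cbo9781316160749, DeligneGoncharov2005, Mathlib:NumberField.abs_discr_gt_two]
#9 RationalTwoCuts (support) — cuts of KZ_{2} are {2}-units (card (O1), S = {2}, rational points): c
∈ ℚ with c, 1 − c both {2}-units ⟺ c ∈ {1/2, 2, −1}; so 1/2 is the only interior rational cut on a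
{0,1}-walled axis over ℤ[1/2] (algebraic {2}-unit cuts cos²(π/2^k) of unbounded degree exist —
finiteness is per degree, Evertse). [difficulty: provable-now] [doi:10.1017/cbo9781316160749,
doi:10.1007/bf01393743]
#9 ConicCalibration (support) — the conic sector of (O2), value level and elementary: if the
rational ellipse {ax² + bxy + cy² < 1} (a, b, c ∈ ℤ, positive definite) has area in ℚ·π then b is
even — hence its model degenerates to a double line mod 2 (bad reduction at 2): area = 2π/√(4ac−b²)
∈ ℚπ forces 4ac − b² = d² with d ∈ ℤ, and b odd would need d² ≡ 3 (mod 4). [difficulty: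
provable-now] [KontsevichZagierPeriods2001,
Mathlib:MeasureTheory.Measure.addHaar_preimage_linearEquiv]

TWO-LAYER PLAN. Foreseen glued splits (none filed now; k ≤ 3, depth 1): PiRamifiedAtTwo ⇐
MovesAreMotivic (Ψ : KZ.FormalRep →+ formal periods,
kills KZ.relations, lands in the pair motive; shared with HodgeColevel D2) → TwoGoodHeredity (2-good
point/matroid data ⇒ Ψ-image in
the coefficient space of motives unramified at 2) → DiscIsotype (Ψ[piRep] spans C(ℚ(−1)⊗χ₋₄) ⊄
C(U₂)) → PiRamifiedAtTwo.
UnimodularKernel ⇐ UnimodularToSimplex (every regular cell is, after ×N, KZ-congruent to a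
ℤ-combination of mzvRep's) → MZV-sector
kernel (CoactionDevissage SectorAssembly shape) → UnimodularKernel. UnimodularValuesAreMZV ⇐
RegularIsMTZ (matroid good at all p ⇒
bi-arrangement motive in MT(ℤ)) → BrownEffectiveReal (effective F_∞-invariant periods of MT(ℤ) are
MZVs) → glue.
TwoGoodDimOne ⇐ DimOneValuesAreLogForms (LowDimension 0405 machinery) → BakerTorsionStep (value ∈
ℚ^×π ⇒ i ∈ ℚ(divisor)) →
UnramifiedCompositum (2-étale divisor ⇒ ℚ(divisor) unramified at 2 ⇒ i ∉ it).

KILL CRITERIA. An explicit chain of moves from N[disc] into the 2-good ring refutes PiRamifiedAtTwo: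
close `refuted:PiRamifiedAtTwo` — and it is
major news (either an H21 move is not a formal-period relator, against Kontsevich's FORMAL period
conjecture, or heredity of good
reduction fails for a KZ pair); report to HodgeColevel/NoriTransfer. A 2-good one-dimensional
rational representation with value
qπ refutes TwoGoodDimOne and (O2) with it: close `refuted:TwoGoodDimOne`, retire the card's π-vs-π²
reading. A regular cell with a
certified non-MZV value (e.g. a rigorous log 2) refutes UnimodularValuesAreMZV: the matroid
definition of 'good' is then wrong for
bi-arrangements — pivot once to the resolved (Dupont) conductor via definition request D1, else
close. UnimodularKernel /
RamifiedReduction are summit-strength: a refutation refutes Conjecture 1 (hand the witness to route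
Neg). Mooted: CoactionDevissage's
sector + a proof of UnimodularToSimplex make UnimodularKernel a corollary; LowDimension's
LowdimBaker0DimLeOne does NOT moot
TwoGoodDimOne (different statement) but shares its machinery.

NOT DECOMPOSED YET. The general conductor (D1: log-good reduction of (ℙⁿ_ℤ, closure of walls ∪ poles
∪ H_∞), intrinsic via the ℚ-Zariski closure of
∂σ ∪ sing f) and the sub-calculus KZ_S (D2) are definition requests; the card's general statements
over them — ConductorBound
(cond r' ⊇ cond_mot(M_gen Ψ r) for r' ~ r; instance NoUnramifiedPi in all dimensions),
ConductorConservativity ((C1): KZ-equivalent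
members of KZ_S are KZ_S-equivalent; S = ∅ member = Ψ_∅-injectivity on cells, finite cut alphabet by
NoCutOverZ) and the modular
target (C2)/U6 (KZ §3.4 Legendre representations of Δ's periods are 2-ramified; find a conductor-∅
one) — are filed as INFORMAL items
right after open. Deliberately not filed: the conductor refactoring ConductorDescent ∧
SameMinimalConductor ⟺ Conjecture 1
(parallel to HodgeColevel; needs D1), unramified-replacement lemmas (TorsionFree's slab trick
×(0,1/n) ramifies at primes of n;
f = f/n + … + f/n is the unramified substitute — ScissorsAvatars DivisibilityScissors), the degree
bound on algebraic S-unit cuts,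
and widening the 2-good family of PiRamifiedAtTwo beyond curves × linear cells (needs D1).

CHEAPEST FALSIFIER. A census of small regular cells: n ≤ 3, rows with entries in {0, ±1}, ≤ 7 rows,
exact matroid test at every prime p below the Hadamard bound of the
subdeterminants (finitely many p decide regularity), numerator 1, then 30-digit evaluation and PSLQ
against {1, ζ(2), ζ(3), ζ(2)², …} ∪ {log 2, π, Catalan}: any regular cell matching a non-MZV
constant kills UnimodularValuesAreMZV
and the arithmetic definition of the sector with it. Done by hand here on six cells (all consistent:
ζ(2)-cell regular → ζ(2);
(0,1)² with 1/(x+y) → 2 log 2 and flagged by det 2; (0,1)³ with 1/(x+y+z−1) flagged by det ±2;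
(0,1)² with 1/((1−y)x)-type braid
cells regular; dimension 1: only ∫_a^(a+1) P ∈ ℚ pass). Not run by kit (no kit in this seat) — first
refuter job. Second cheapest:
check TwoGoodDimOne's encoding on ∫₀^∞ dx/(1+x²), ∫_(x²<3) dx/(x²+3), ∫₀¹ (2x+1)dx/(x²+x+1)
(expected: 2-bad, 2-bad, 2-good with value log 3).

NUMBERS. S-unit cuts on a {0,1}-walled axis: S = ∅: none, rational or algebraic (Hermite–Minkowski +
units of ℤ); S = {2}: rational solutions of
x + y = 1 are (1/2,1/2), (2,−1), (−1,2), interior cut 1/2 only; algebraic {2}-unit cuts exist in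
every ℚ(ζ_(2^k))⁺ (u = cos²(jπ/2^k),
1 − u = sin²), so finiteness holds per bounded degree only (Evertse 1984: ≤ 3·7^(d+2s) solutions in
a field of degree d; correction
to the card's 'finitely many cuts per configuration'). Conductors computed here (walls ∪ poles ∪ ∞):
[x²+y²<1] ↦ {2}; [ℝ, 1/(1+x²)] ↦ {2};
[(0,1), 4/(1+x²)] ↦ {2} (i ≡ 1 mod 1+i); [x²+xy+y²<1] and [ℝ, 1/(x²+x+1)] ↦ {3}; [ℝ, 1/(x²+3)] ↦
{2,3} (same motive as the previous,
order ℤ[√−3] non-maximal at 2: arrangement conductor ⊋ motivic conductor, joined by the 2-ramified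
move x ↦ 2x+1); ζ(2)-cell ↦ ∅;
[(1,2), 1/x] = log 2 ↦ {2}; [(1,3), 1/x] = log 3 ↦ {2,3} but [(0,1), (2x+1)/(x²+x+1)] = log 3 ↦ {3}
(answers the card's U2′: log 3 IS
representable unramified at 2, in dimension 1); [(0,1)², 1/(x+y)] = 2 log 2 ↦ ∋ 2 (det(x=1, y=1,
x+y=0) = 2); rational ellipse with
area ∈ ℚπ ⇒ b even ⇒ double line mod 2. Motives: M([disc]) = H²(𝔸², circle) = H¹(R¹_(ℚ(i)/ℚ) 𝔾_m) =
ℚ(−1)⊗χ₋₄; Eisenstein ℚ(−1)⊗χ₋₃;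
identical Hodge numbers, conductors 2² vs 3. Items at open: 12 (target, assembly, 4 typed cruxes, 6
supports); after open: 2
informal cruxes (ConductorBound rank 6, ConductorConservativity rank 7), 1 informal support
(UnramifiedModularPeriods), 3
definition requests.

DEFINITION REQUESTS. D1 `KZ.arrangementConductor` (Literature/NumberTheory/Transcendental, addendum
to KZCalculus): for a polynomial presentation of
a representation (sign conditions on a finite family of ℚ-polynomials for σ, p/q for f) the finite
set of primes p at which
(ℙⁿ_ℤ₍ₚ₎, closure of walls ∪ poles ∪ H_∞) admits no log-smooth model (equivalently: reduction type
changes); API: the three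
elementary instances must be theorems — points on ℙ¹ (separable reduction & no degree drop of the
primitive divisor polynomial, as
in TwoGoodDimOne), linear cells (matroid ranks over 𝔽_p = over ℚ, as in UnimodularKernel), products
(union); intrinsic version
`KZ.conductor r` := conductor of the ℚ-Zariski closure of ∂σ ∪ (non-regular locus of f on σ); lemma
cond_arrangement ⊇ cond_motivic.
D2 `KZ.localRelations (S : Finset ℕ) : AddSubgroup KZ.FormalRep` (KZ_S): closure of the move
instances (1a),(1b),(2),(3) all of
whose data (the three representations, the cutting hypersurface, the graph of Φ, the graph and
zero/pole loci of the primitive F,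
the band functions a, b) have arrangementConductor ⊆ S; lemma localRelations S ≤ KZ.relations,
monotone in S.
D3 `KZ.motivicConductor` over the shared Ψ = `KZ.noriSymbol` (HodgeColevel's request D2): primes of
ramification of the ℓ-adic
realisation of the Nori motive generated by Ψ[r]; heredity lemma (subquotients/tensors of unramified
are unramified).
Cite facts wanted: Evertse 1984 / Evertse–Győry 2015 Thm 6.1.x (S-unit equation: finiteness and the
bound 3·7^(d+2s));
DeligneGoncharov2005 §1.4–1.8 (MT(ℤ[1/S]) = objects of MT(ℚ) unramified outside S); Brown2012 Thm
1.1 + 'effective real motivic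
periods of MT(ℤ) = motivic MZVs'; Dupont 2017 (arXiv:1410.6348) Thm 1.x (bi-arrangement relative
cohomology is mixed Tate); smooth
and proper base change for pairs (good reduction ⇒ unramified Hⁿ(X,D)); Fontaine 1985 (no abelian
scheme over ℤ) for (C2).

Novelty: Searches (2026-08-15): `lit frontier KontsevichZagierPeriods --since 2021` (30 rows; nearest
arXiv:2302.07650 arithmetic of periods
of rational forms over 𝔽₂-type settings and arXiv:2503.02096 motivic coactions at genus 0 — values,
no grading of representations);
`lit bridges KontsevichZagierPeriods --cross any` (30 rows, none relevant); `lit search --source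
zbmath`: "relative cohomology of
bi-arrangements mixed Tate Dupont" (1: arXiv:1410.6348), "mixed Tate motives over Z Brown" (5:
arXiv:1102.1312, arXiv:math/0606419,
Deligne Bourbaki zbl:1346.14059, arXiv:1504.04737, arXiv:1512.03975), "groupes fondamentaux
motiviques de Tate mixte Deligne
Goncharov" (3: arXiv:math/0302267, doi:10.4171/dms/5/21 Yamashita p-adic multiple L-values, Minh),
"hyperplane arrangement matroid
reduction modulo p mixed Tate motive unramified" (0), "conductor ramification periods Kontsevich
Zagier conjecture" (0), "periods
hyperplane arrangements multiple zeta values unimodular" (0), "Artin Tate motives good reduction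
periods pi" (0), "unit equation
finitely many solutions S-units Evertse" (5: doi:10.1017/cbo9781316160749, doi:10.1007/bf01393743,
doi:10.1007/bf01233421, …);
`lit search --source arxiv` "good reduction hyperplane arrangement periods multiple zeta" (0),
"Kontsevich-Zagier period conjecture
arithmetic refinement primes" (0); `lit galaxy search "periods of mixed Tate motives unramified good
reduction hyperplane
arrangement" --star all` (0 over panama+pdf+crabby); `lit search --hybrid …` u  [refs: 10.4171/dms/5/21, 10.1017/cbo9781316160749, 10.1007/bf01393743, 10.1007/bf01233421, 2302.07650, 2503.02096, 1410.6348, 1102.1312, math/0606419, 1504.04737, 1512.03975, math/0302267, doi:10.4171/dms/5/21, doi:10.1017/cbo9781316160749, doi:10.1007/bf01393743, doi:10.1007/bf01233421, DeligneGoncharov2005, Brown2012]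

Barriers (technique_class: arithmetic-grading, conductor-bound, conservativity): - technique_class: arithmetic-grading, conductor-bound, conservativity
- Literature.Barriers.KontsevichZagierPeriods.kzConjecture_implies_oddZetaAlgIndep: conceded for the
cores only (Target ⟺ Conjecture 1; UnimodularKernel is the MZV-sector kernel in arithmetic dress);
EVADED by the engine: PiRamifiedAtTwo is a non-existence-of-chains statement proved from
ramification data via Ψ, UnimodularValuesAreMZV a membership statement from MT(ℤ),
NoCutOverZ/RationalTwoCuts pure arithmetic — no independence of values is asserted anywhere.
- Literature.Barriers.KontsevichZagierPeriods.kzConjecture_implies_twoPiI_log_algIndep: conceded for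
the cores likewise; the conductor computations for log 2 ({2}) vs log 3 ({3}, via (2x+1)/(x²+x+1))
are value-free, and TwoGoodDimOne uses transcendence only through Baker's THEOREM in dimension 1.
- Literature.Barriers.KontsevichZagierPeriods.kzConjecture_implies_ellipticPeriods_algIndep: not
engaged (no elliptic or modular period is typed; the (C2) target on Δ's periods stays informal).
- Literature.Barriers.KontsevichZagierPeriods.noSemialgebraicPrimitive_inv_sub_two: not engaged — no
variable is integrated out and no primitive is posited; its own identity ∫₀¹dt/(2−t) = ∫₁²dt/t has
conductor {2} on both sides (walls 0,1,2,∞ collide mod 2), a calibration for D1, and shows moves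
need not change conductor.
- Literature.Barriers.KontsevichZagierPeriods.cressonViuSos_prop_3_2: not engaged — scissors are
kept; KZ_S restricts WHERE one may cut and never po

History (route lifecycle, newest last):
- 2026-08-15T12:48:48Z · rev 1: restated Target (stmt-KontsevichZagierPeriods-8402) — materialise Target: the gate rendered rank-0 Target before the decls it names (BLOCKED comment); restated with the conjunction inlined over existing declaration (planner-plancard-KontsevichZagierPeriods-Kont-3101fc55-0)
- 2026-08-15T16:14:34Z · rev 3: restated TwoGoodDimOne (stmt-KontsevichZagierPeriods-8406), Assembly (stmt-KontsevichZagierPeriods-8411) — route-repair (cone): re-routed around the 16 unproved PeriodsWave0 facts — they rode in on `import …PeriodsWave0`, needed only for the constant `baker` in TwoGo (planner-rbadge-KontsevichZagierPeriods-PeriodC-500ffdac-g4-0)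
- 2026-08-15T16:14:34Z · rev 3: dropped KernelImpliesStatement — route-repair (cone): re-routed around the 16 unproved PeriodsWave0 facts — they rode in on `import …PeriodsWave0`, needed only for the constant `baker` in TwoGo (planner-rbadge-KontsevichZagierPeriods-PeriodC-500ffdac-g4-0)
- 2026-08-16T02:18:24Z · AUTO-CRUX: 2 conjecture-grade item(s) promoted to crux (RamifiedReduction, Target) — refuter vetting / tiering apply (operator:999:1362873)
- 2026-08-23T15:56:21Z · DORMANT — reconciler: no traction for 6.1 d (last activity item-evidence-added at 2026-08-17T12:52:25Z); parked, not closed — `ledger route dormant route-KontsevichZagier (operator:999:589679)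
- 2026-08-31T13:08:23Z · REACTIVATED (open) — reconciler: reactivated — activity statement-checked at 2026-08-31T11:52:48Z after parking at 2026-08-23T15:56:21Z (operator:999:2555626)

sub-problem: KontsevichZagierPeriods · status: open · opened planner-plancard-KontsevichZagierPeriods-Kont-3101fc55-0 2026-08-15T12:46:52Z · rev 4 · ledger route-KontsevichZagierPeriods-PeriodConductors
GENERATED by the gate from the ledger (D-0016/17). Provers cite these decls: `theorem foo : Summit.KontsevichZagierPeriods.KontsevichZagierPeriods.Theses.PeriodConductors.<Decl> := …` in Summits/KontsevichZagierPeriods/KontsevichZagierPeriods/Theorems/<Name>.lean.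
-/

namespace Summit.KontsevichZagierPeriods.KontsevichZagierPeriods.Theses.PeriodConductors

open scoped BigOperators Topology Manifold Classical MeasureTheory ProbabilityTheory Matrix InnerProductSpace ComplexConjugate ContinuousMap
open Filter Set Function TopologicalSpace MeasureTheory

attribute [summit_statement] _root_.KontsevichZagierPeriods

open Literature Periods

-- earlier Target (stmt-KontsevichZagierPeriods-8402, replaced 2026-08-15T12:48:48Z -> stmt-KontsevichZagierPeriods-8436): retired by None — UnimodularKernel ∧ RamifiedReduction
/-- item stmt-KontsevichZagierPeriods-8436 · target · rank 0 · open · by planner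
why it might fail: X ⟺ Conjecture 1 (RamifiedReduction ⇐ summit with c' = 0; UnimodularKernel ⇐ kernel form): every strength barrier of the summit applies to X as a whole; the arithmetic split only relocates difficulty by conductor.
sources: KontsevichZagierPeriods2001, HuberMullerStachPeriods2017, Brown2012
[target] X = UnimodularKernel ∧ RamifiedReduction (inlined verbatim so the decl does not depend on
file order; `Target ↔ UnimodularKernel ∧ RamifiedReduction` is Iff.rfl): Conjecture 1 over Spec ℤ on
the regular-matroid linear sector, and the reduction of every vanishing formal combination to that
sector. -/
@[route_item "route-KontsevichZagierPeriods-PeriodConductors"]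
def Target : Prop :=
  (let lin : (n : ℕ) → (k : ℕ) → (Fin k → Fin (n + 1) → ℤ) → Fin k → (Fin n → ℝ) → ℝ := fun n _ M i x => (M i 0 : ℝ) + ∑ j : Fin n, (M i j.succ : ℝ) * x j; let good : (n : ℕ) → (k : ℕ) → ℕ → (Fin k → Fin (n + 1) → ℤ) → Prop := fun n k p M => ∀ T : Finset (Fin k), (Matrix.of fun (i : T) (j : Fin (n + 1)) => (M i j : ZMod p)).rank = (Matrix.of fun (i : T) (j : Fin (n + 1)) => (M i j : ℚ)).rank; let cell : Finset ℕ → Set Literature.NumberTheory.Transcendental.KZ.FormalRep := fun S => {x | ∃ (n k : ℕ) (M : Fin k → Fin (n + 1) → ℤ) (w : Fin k → Bool) (m : Fin k → ℕ) (P : MvPolynomial (Fin n) ℚ) (r : Literature.NumberTheory.Transcendental.KZ.IntegralRep n), (∃ i, M i = Pi.single 0 1) ∧ (∀ p : ℕ, p.Prime → p ∉ S → good n k p M) ∧ r.domain = {x | ∀ i, w i = true → 0 < lin n k M i x} ∧ Set.EqOn r.integrand (fun x => MvPolynomial.aeval x P / ∏ i, lin n k M i x ^ m i) r.domain ∧ x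 = Literature.NumberTheory.Transcendental.KZ.of r}; ∀ c ∈ AddSubgroup.closure (cell ∅), Literature.NumberTheory.Transcendental.KZ.eval c = 0 → c ∈ Literature.NumberTheory.Transcendental.KZ.relations) ∧ (let lin : (n : ℕ) → (k : ℕ) → (Fin k → Fin (n + 1) → ℤ) → Fin k → (Fin n → ℝ) → ℝ := fun n _ M i x => (M i 0 : ℝ) + ∑ j : Fin n, (M i j.succ : ℝ) * x j; let good : (n : ℕ) → (k : ℕ) → ℕ → (Fin k → Fin (n + 1) → ℤ) → Prop := fun n k p M => ∀ T : Finset (Fin k), (Matrix.of fun (i : T) (j : Fin (n + 1)) => (M i j : ZMod p)).rank = (Matrix.of fun (i : T) (j : Fin (n + 1)) => (M i j : ℚ)).rank; let cell : Finset ℕ → Set Literature.NumberTheory.Transcendental.KZ.FormalRep := fun S => {x | ∃ (n k : ℕ) (M : Fin k → Fin (n + 1) → ℤ) (w : Fin k → Bool) (m : Fin k → ℕ) (P : MvPolynomial (Fin n) ℚ) (r : Literature.NumberTheory.Transcendental.KZ.IntegralRep n), (∃ i, M i = Pi.single 0 1) ∧ (∀ p : ℕ, p.Prime → p ∉ S →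 good n k p M) ∧ r.domain = {x | ∀ i, w i = true → 0 < lin n k M i x} ∧ Set.EqOn r.integrand (fun x => MvPolynomial.aeval x P / ∏ i, lin n k M i x ^ m i) r.domain ∧ x = Literature.NumberTheory.Transcendental.KZ.of r}; ∀ c : Literature.NumberTheory.Transcendental.KZ.FormalRep, Literature.NumberTheory.Transcendental.KZ.eval c = 0 → ∃ c' ∈ AddSubgroup.closure (cell ∅), Literature.NumberTheory.Transcendental.KZ.eval c' = 0 ∧ c - c' ∈ Literature.NumberTheory.Transcendental.KZ.relations)

/-- item stmt-KontsevichZagierPeriods-8404 · crux · rank 3 · open · by planner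
why it might fail: Conjecture-1 strength on the sector: contains all ℚ-relations among MZV-valued cells incl. non-graphic regular matroids (R₁₀, cographic K₃₃) where Fubini leaves the linear world (no linear reducibility), plus every regularised double-shuffle consequence with convergent intermediates.
sources: KontsevichZagierPeriods2001, Brown2012, arXiv:math/0606419, arXiv:1410.6348, HuberMullerStachPeriods2017
[crux] "Conjecture 1 over Spec ℤ" on the regular-matroid linear sector (card (C1)/(C2) at S = ∅,
plain-relations form): every ℤ-combination c of representations [r], r over an open rational linear
cell {ℓ_i > 0} with integrand P(x)/∏ ℓ_i(x)^(m_i) (P ∈ ℚ[x], ℓ_i integral affine forms, one row the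
hyperplane at infinity) whose matroid has the same ranks over every 𝔽_p as over ℚ, with KZ.eval c =
0, lies in KZ.relations. By UnimodularValuesAreMZV its value content is the ℚ-relations among MZVs
presented by regular cells (all dimensions, all polytopes — graphic, cographic and sporadic regular
matroids), i.e. CoactionDevissage's MZV sector PLUS the accessibility 'every regular cell is
KZ-congruent to simplex combinations'. [deps: UnimodularValuesAreMZV] [difficulty: open-problem] -/
@[route_item "route-KontsevichZagierPeriods-PeriodConductors", crux]
def UnimodularKernel : Prop :=
  let lin : (n : ℕ) → (k : ℕ) → (Fin k → Fin (n + 1) → ℤ) → Fin k → (Fin n → ℝ) → ℝ := fun n _ M i x => (M i 0 : ℝ) + ∑ j : Fin n, (M i j.succ : ℝ) * x j; let good : (n : ℕ) → (k : ℕ) → ℕ → (Fin k → Fin (n + 1) → ℤ) → Prop := fun n k p M => ∀ T : Finset (Fin k), (Matrix.of fun (i : T) (j : Fin (n + 1)) => (M i j : ZMod p)).rank = (Matrix.of fun (i : T) (j : Fin (n + 1)) => (M i j : ℚ)).rank; let cell : Finset ℕ → Set Literature.NumberTheory.Transcendental.KZ.FormalRep := fun S => {x | ∃ (n k : ℕ)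 (M : Fin k → Fin (n + 1) → ℤ) (w : Fin k → Bool) (m : Fin k → ℕ) (P : MvPolynomial (Fin n) ℚ) (r : Literature.NumberTheory.Transcendental.KZ.IntegralRep n), (∃ i, M i = Pi.single 0 1) ∧ (∀ p : ℕ, p.Prime → p ∉ S → good n k p M) ∧ r.domain = {x | ∀ i, w i = true → 0 < lin n k M i x} ∧ Set.EqOn r.integrand (fun x => MvPolynomial.aeval x P / ∏ i, lin n k M i x ^ m i) r.domain ∧ x = Literature.NumberTheory.Transcendental.KZ.of r}; ∀ c ∈ AddSubgroup.closure (cell ∅), Literature.NumberTheory.Transcendental.KZ.eval c = 0 → c ∈ Literature.NumberTheory.Transcendental.KZ.relations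

/-- item stmt-KontsevichZagierPeriods-8407 · crux (kind.auto-crux: conjecture-grade) · rank 9 · open · by planner
why it might fail: auto-crux — conjecture-grade statement (docstring avows it ('Conjecture')); it is open, so it may simply be false
sources: KontsevichZagierPeriods2001, HuberMullerStachPeriods2017
[support] the honest complement of the sector (Conjecture 1 off the unramified linear sector): every
formal combination c with KZ.eval c = 0 is KZ-congruent to some vanishing c' in the ℤ-span of
everywhere-good linear-cell representations (under Conjecture 1 take c' = 0). Summit-strength, not
this route's bet, not staffed. [difficulty: open-problem] -/
@[route_item "route-KontsevichZagierPeriods-PeriodConductors", crux]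
def RamifiedReduction : Prop :=
  let lin : (n : ℕ) → (k : ℕ) → (Fin k → Fin (n + 1) → ℤ) → Fin k → (Fin n → ℝ) → ℝ := fun n _ M i x => (M i 0 : ℝ) + ∑ j : Fin n, (M i j.succ : ℝ) * x j; let good : (n : ℕ) → (k : ℕ) → ℕ → (Fin k → Fin (n + 1) → ℤ) → Prop := fun n k p M => ∀ T : Finset (Fin k), (Matrix.of fun (i : T) (j : Fin (n + 1)) => (M i j : ZMod p)).rank = (Matrix.of fun (i : T) (j : Fin (n + 1)) => (M i j : ℚ)).rank; let cell : Finset ℕ → Set Literature.NumberTheory.Transcendental.KZ.FormalRep := fun S => {x | ∃ (n k : ℕ) (M : Fin k → Fin (n + 1) → ℤ) (w : Fin k → Bool) (m : Fin k → ℕ) (P : MvPolynomial (Fin n) ℚ) (r : Literature.NumberTheory.Transcendental.KZ.IntegralRep n), (∃ i, M i = Pi.single 0 1) ∧ (∀ p : ℕ, p.Prime → p ∉ S → good n k p M) ∧ r.domain = {x | ∀ i, w i = true → 0 < lin n k M i x} ∧ Set.EqOn r.integrand (fun x => MvPolynomial.aeval x P / ∏ i, lin n k M i x ^ m i) r.domain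 ∧ x = Literature.NumberTheory.Transcendental.KZ.of r}; ∀ c : Literature.NumberTheory.Transcendental.KZ.FormalRep, Literature.NumberTheory.Transcendental.KZ.eval c = 0 → ∃ c' ∈ AddSubgroup.closure (cell ∅), Literature.NumberTheory.Transcendental.KZ.eval c' = 0 ∧ c - c' ∈ Literature.NumberTheory.Transcendental.KZ.relations

/-- item stmt-KontsevichZagierPeriods-8403 · aside · rank 2 · open · by planner
why it might fail: Rides on the unbuilt Ψ and on '2-good point/matroid data ⇒ pair motive unramified at 2' (for bi-arrangements with poles on cell faces the blow-ups must stay good over ℤ₍₂₎ — unprinted); the value shadow 'Nπ ∉ ring of 2-good curve/linear periods' is GPC-strength, so no Ψ-free proof exists.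
sources: KontsevichZagierPeriods2001, HuberMullerStachPeriods2017, DeligneGoncharov2005, arXiv:1410.6348, arXiv:1102.1312
[crux] rules-level "π is ramified at 2" (card (O2)/(O3), typable fragment of NoUnramifiedPi): for
every N ≠ 0 and every c in the (non-unital) subring of KZ.FormalRep generated by (a) one-dimensional
representations of KZ-rational shape whose divisor (boundary points ∪ complex poles ∪ ∞ ⊂ ℙ¹) is
étale at 2 — witnessed by an integer polynomial G ≠ 0 vanishing on boundary points and poles with G
mod 2 separable of the same degree — and (b) representations over open linear cells with linear
poles whose matroid (primitive rows incl. the hyperplane at infinity) has the same ranks over 𝔽₂ as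
over ℚ, the element N•[KZ.piRep] − c is NOT a KZ relation. Route to a proof: Ψ sends c into the
coefficient space of U₂ = Nori motives unramified at 2 (Tannakian, closed under subquotients), while
Ψ[piRep] spans C(H¹(norm-one torus)) = C(ℚ(−1)⊗χ₋₄), and C(N) ⊆ C(U₂) forces N ∈ U₂ — but χ₋₄ is
ramified at 2. The family contains 2π/√3 = [ℝ, 1/(x²+x+1)], log 3 = [(0,1), (2x+1)/(x²+x+1)],
Li-values at 1/3, all MZV cells, golden-ratio-field algebraic lengths; single instances with known
values are provable now by soundness (Nπ ≠ 2Mπ/√3). [difficulty: XL] -/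
@[route_item "route-KontsevichZagierPeriods-PeriodConductors"]
def PiRamifiedAtTwo : Prop :=
  let twoGood : Literature.NumberTheory.Transcendental.KZ.IntegralRep 1 → Prop := fun r => ∃ (p q : MvPolynomial (Fin 1) ℚ) (G : Polynomial ℤ), (∀ x ∈ r.domain, MvPolynomial.aeval x q ≠ 0) ∧ Set.EqOn r.integrand (fun x => MvPolynomial.aeval x p / MvPolynomial.aeval x q) r.domain ∧ G ≠ 0 ∧ (∀ x ∈ frontier r.domain, Polynomial.aeval (x 0) G = 0) ∧ (∀ z : ℂ, MvPolynomial.aeval (fun _ => z) q = 0 → Polynomial.aeval z G = 0) ∧ (G.map (Int.castRingHom (ZMod 2))).natDegree = G.natDegree ∧ (G.map (Int.castRingHom (ZMod 2))).Separable; let lin : (n : ℕ) → (k : ℕ) → (Fin k → Fin (n + 1) → ℤ) → Fin k → (Fin n → ℝ) → ℝ := fun n _ M i x => (M i 0 : ℝ) + ∑ j : Fin n, (M i j.succ : ℝ) * x j; let linTwoGood : Set Literature.NumberTheory.Transcendental.KZ.FormalRep := {x | ∃ (n k : ℕ) (M : Fin k → Fin (n + 1) → ℤ) (w : Fin k → Bool)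 (m : Fin k → ℕ) (P : MvPolynomial (Fin n) ℚ) (r : Literature.NumberTheory.Transcendental.KZ.IntegralRep n), (∃ i, M i = Pi.single 0 1) ∧ (∀ T : Finset (Fin k), (Matrix.of fun (i : T) (j : Fin (n + 1)) => (M i j : ZMod 2)).rank = (Matrix.of fun (i : T) (j : Fin (n + 1)) => (M i j : ℚ)).rank) ∧ r.domain = {x | ∀ i, w i = true → 0 < lin n k M i x} ∧ Set.EqOn r.integrand (fun x => MvPolynomial.aeval x P / ∏ i, lin n k M i x ^ m i) r.domain ∧ x = Literature.NumberTheory.Transcendental.KZ.of r}; ∀ N : ℕ, N ≠ 0 → ∀ c ∈ NonUnitalSubring.closure ({x | ∃ r : Literature.NumberTheory.Transcendental.KZ.IntegralRep 1, twoGood r ∧ x = Literature.NumberTheory.Transcendental.KZ.of r} ∪ linTwoGood), N • Literature.NumberTheory.Transcendental.KZ.of Literature.NumberTheory.Transcendental.KZ.piRep - c ∉ Literature.NumberTheory.Transcendental.KZ.relations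

/-- item stmt-KontsevichZagierPeriods-8405 · aside · rank 4 · open · by planner
why it might fail: 'Matroid good at p ⇒ motive unramified at p' is printed for arrangement complements, not for BI-arrangements with poles on cell faces (Dupont's blow-ups add exceptional divisors whose reduction is unchecked); one regular cell integrating to a certified non-MZV (a log 2) kills it.
sources: Brown2012, arXiv:1102.1312, DeligneGoncharov2005, arXiv:math/0302267, arXiv:1410.6348, arXiv:math/0606419
[crux] the unramified linear world is Brown's (card (C2) at S = ∅, value level): the value of every
representation over an open rational linear cell with linear poles whose matroid (incl. the
hyperplane at infinity) has good reduction at EVERY prime lies in the ℚ-span of the multiple zeta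
values (⨆_w mzvSpace w). Chain: matroid good at all p ⇒ motive of the bi-arrangement pair mixed Tate
(Dupont) and unramified everywhere ⇒ in MT(ℤ) (Deligne–Goncharov) ⇒ effective
real-Frobenius-invariant period ⇒ MZV (Brown 2012). Calibrations done here: ζ(2)-cell regular ✓;
[(0,1)², 1/(x+y)] = 2 log 2 is flagged (rows x=1, y=1, x+y=0 have determinant 2); [(0,1)³,
1/(x+y+z−1)] flagged (determinant ±2); in dimension 1 only ∫_a^(a+1) P dx ∈ ℚ survive. [difficulty:
XL] -/
@[route_item "route-KontsevichZagierPeriods-PeriodConductors"]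
def UnimodularValuesAreMZV : Prop :=
  let lin : (n : ℕ) → (k : ℕ) → (Fin k → Fin (n + 1) → ℤ) → Fin k → (Fin n → ℝ) → ℝ := fun n _ M i x => (M i 0 : ℝ) + ∑ j : Fin n, (M i j.succ : ℝ) * x j; let good : (n : ℕ) → (k : ℕ) → ℕ → (Fin k → Fin (n + 1) → ℤ) → Prop := fun n k p M => ∀ T : Finset (Fin k), (Matrix.of fun (i : T) (j : Fin (n + 1)) => (M i j : ZMod p)).rank = (Matrix.of fun (i : T) (j : Fin (n + 1)) => (M i j : ℚ)).rank; let cell : Finset ℕ → Set Literature.NumberTheory.Transcendental.KZ.FormalRep := fun S => {x | ∃ (n k : ℕ) (M : Fin k → Fin (n + 1) → ℤ) (w : Fin k → Bool) (m : Fin k → ℕ) (P : MvPolynomial (Fin n) ℚ) (r : Literature.NumberTheory.Transcendental.KZ.IntegralRep n), (∃ i, M i = Pi.single 0 1) ∧ (∀ p : ℕ, p.Prime → p ∉ S → good n k p M) ∧ r.domain = {x | ∀ i, w i = true → 0 < lin n k M i x} ∧ Set.EqOn r.integrand (fun x => MvPolynomial.aeval x P / ∏ i, lin n k M i x ^ m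 i) r.domain ∧ x = Literature.NumberTheory.Transcendental.KZ.of r}; ∀ x ∈ cell ∅, Literature.NumberTheory.Transcendental.KZ.eval x ∈ ⨆ w, Literature.NumberTheory.Transcendental.mzvSpace w

-- earlier TwoGoodDimOne (stmt-KontsevichZagierPeriods-8406, replaced 2026-08-15T16:14:34Z -> stmt-KontsevichZagierPeriods-10399): retired by None — let twoGood : Literature.NumberTheory.Transcendental.KZ.IntegralRep 1 → Prop := fun r => ∃ (p q : MvPolynomial (Fin 1) ℚ) (G : Polynomial ℤ), (∀ x ∈ r.domain, MvPolynomial.aeval x q ≠ 0) ∧ Set.EqOn r.integrand (fun x => MvPolynomial.aeval x p / MvPolynom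
/-- item stmt-KontsevichZagierPeriods-10399 · aside · rank 5 · open · by planner
why it might fail: True on paper via Baker; risks are the encoding (isolated boundary points, removable poles, unbounded pieces, ∞ always a wall) and the Lean cost of 'dim-1 values are ℚ̄-linear forms in logs' + branch/torsion bookkeeping (LowDimension 0405 machinery, unbuilt).
sources: Baker1966, Baker1975, HuberWustholz2022, KontsevichZagierPeriods2001, Literature.NumberTheory.Transcendental.baker (statement inlined verbatim, universe 0)
[crux] the d = 1 rung of NoUnramifiedPi at VALUE level, from Baker (card (O2), unconditional in
dimension 1 modulo Baker's theorem): assuming BAKER'S THEOREM — stated verbatim as the antecedent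
(ℚ̄-linear independence of 1, l₁, …, lₙ for ℚ-linearly independent logarithms lᵢ of algebraic
numbers; this is the body of the tree's named fact Literature.NumberTheory.Transcendental.baker at
universe 0, and the restated decl is `Iff.rfl`-equal to rev ≤ 2's `baker.{0} → …`; inlined
2026-08-15 so that the route no longer imports PeriodsWave0 and its cone carries no unproved named
fact) — a one-dimensional representation of KZ-rational shape whose divisor (boundary points ∪ poles
∪ ∞) is étale at 2 (witness: G ∈ ℤ[x], G ≠ 0, vanishing at every frontier point of the domain and
every complex zero of q, with G mod 2 of the same degree and separable) never has value in ℚ^×·π.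
Paper proof (this route; audited TRUE-conditional-on-Baker by refuters g40-52, g41-21, g41-37,
g40-61 at rev 1): value = α + Σ β_j Log γ_j with α, β_j, γ_j in K = ℚ(divisor); value = sπ, s ∈ ℚ^×
forces, by Baker and torsion bookkeeping, i·s ∈ K, i.e. i ∈ K; but each ℚ(θ), θ in the divisor, is
unramified at 2, hence so is K — -/
@[route_item "route-KontsevichZagierPeriods-PeriodConductors"]
def TwoGoodDimOne : Prop :=
  let twoGood : Literature.NumberTheory.Transcendental.KZ.IntegralRep 1 → Prop := fun r => ∃ (p q : MvPolynomial (Fin 1) ℚ) (G : Polynomial ℤ), (∀ x ∈ r.domain, MvPolynomial.aeval x q ≠ 0) ∧ Set.EqOn r.integrand (fun x => MvPolynomial.aeval x p / MvPolynomial.aeval x q) r.domain ∧ G ≠ 0 ∧ (∀ x ∈ frontier r.domain, Polynomial.aeval (x 0) G = 0) ∧ (∀ z : ℂ, MvPolynomial.aeval (fun _ => z) q = 0 → Polynomial.aeval z G = 0) ∧ (G.map (Int.castRingHom (ZMod 2))).natDegree = G.natDegree ∧ (G.map (Int.castRingHom (ZMod 2))).Separable; (∀ {ι : Type} (l : ι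 → ℂ), (∀ i, IsAlgebraic ℚ (Complex.exp (l i))) → LinearIndependent ℚ l → LinearIndependent (algebraicClosure ℚ ℂ) fun o : Option ι => o.elim 1 l) → ∀ r : Literature.NumberTheory.Transcendental.KZ.IntegralRep 1, twoGood r → ∀ q : ℚ, q ≠ 0 → r.value ≠ (q : ℝ) * Real.pi

-- item stmt-KontsevichZagierPeriods-8438 · support · rank 6 · open · by planner — informal only, no Lean statement yet:
--   [crux] ConductorBound (card (O3), general schema over the requested definitions D1
--   KZ.arrangementConductor / D3 KZ.motivicConductor and the shared Ψ = KZ.noriSymbol): for all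
--   representations r ~ r′ (KZ.Equivalent), arrangementConductor r′ ⊇ motivicConductor (motive generated
--   by Ψ[r]) — because Ψ r = Ψ r′, the generated Nori motive is intrinsic to the KZ-class, and the
--   conductor of a pair motive is contained in the bad-reduction set of any pair presenting it
--   (smooth–proper base change + heredity to subquotients). Typed instance in all dimensions once D1
--   lands: NoUnramifiedPi := ¬ ∃ (n) (r′ : KZ

-- item stmt-KontsevichZagierPeriods-8439 · support · rank 7 · open · by planner — informal only, no Lean statement yet:
--   [crux] ConductorConservativity (card (C1), over the requested D2 KZ.localRelations S =: KZ_S): for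
--   every finite set of primes S and all representations r, r′ with arrangementConductor ⊆ S,
--   KZ.Equivalent r r′ → [r] − [r′] ∈ KZ.localRelations S ("a proof need not ramify where the identity
--   does not"). Tannakian support: motives with good reduction outside S form a full Tannakian
--   subcategory stable under subquotients, so their formal period algebra injects into the full one;
--   hence (C1) ⇐ Ψ_S-injectivity (the moves of conductor ⊆ S generate all motivic relations among their
--   own symbols). The S = ∅

/-- item stmt-KontsevichZagierPeriods-3168 · support · rank 9 · open · by planner
sources: KontsevichZagierPeriods2001, stmt-KontsevichZagierPeriods-3168, Brown2012
[crux] Euler's ζ(2) = π²/6 inside the calculus: 6 • [ζ(2)-simplex rep] − [disc]·[disc] ∈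
KZ.relations, where [disc] = KZ.piRep (closed unit disc, integrand 1) and · is the product of
representations (KZProduct). The pure/invariant part of the sector (card D3): it ties the MZV
fragment to the [π]-powers of the rest of P_KZ. [difficulty: M] -/
@[route_item "route-KontsevichZagierPeriods-PeriodConductors"]
def EulerBasel : Prop :=
  let ρ : List ℕ → Literature.NumberTheory.Transcendental.KZ.FormalRep := fun u => if h : Literature.NumberTheory.Transcendental.MZV.IsAdmissible u then Literature.NumberTheory.Transcendental.KZ.of (Literature.NumberTheory.Transcendental.KZ.mzvRep u h (Literature.NumberTheory.Transcendental.KZ.mzvIntegrand_isSemialgebraicFunOn_holds u) (Literature.NumberTheory.Transcendental.KZ.mzvIntegrand_integrableOn_holds u h)) else 0; 6 • ρ [2] - Literature.NumberTheory.Transcendental.KZ.of Literature.NumberTheory.Transcendental.KZ.piRep * Literature.NumberTheory.Transcendental.KZ.of Literature.NumberTheory.Transcendental.KZ.piRep ∈ Literature.NumberTheory.Transcendental.KZ.relations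

/-- item stmt-KontsevichZagierPeriods-8408 · support · rank 9 · closed · proved by Summit.KontsevichZagierPeriods.PeriodConductors.noCutOverZ_proof @ 6a6ce5b29e8a (prover) · by planner
sources: doi:10.1017/cbo9781316160749, DeligneGoncharov2005, Mathlib:NumberField.abs_discr_gt_two
[support] over Spec ℤ there is nowhere to cut (card (O1), all algebraic cut points): if c and 1 − c
are both units of the ring of integers of a number field K then |disc K| > 2 (so K ≠ ℚ and some
prime ramifies: an admissible cut of KZ_∅ on a {0,1}-walled axis does not exist, rational or
algebraic). Mathlib: NumberField.abs_discr_gt_two + units of ℤ are ±1. [difficulty: provable-now] -/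
@[route_item "route-KontsevichZagierPeriods-PeriodConductors"]
def NoCutOverZ : Prop :=
  ∀ (K : Type) [Field K] [NumberField K] (c : NumberField.RingOfIntegers K), IsUnit c → IsUnit (1 - c) → 2 < |NumberField.discr K|

-- `NoCutOverZ` holds: proved by `Summit.KontsevichZagierPeriods.PeriodConductors.noCutOverZ_proof` @ 6a6ce5b29e8a (its module imports this route file, so no `_holds` link can be stated here).

/-- item stmt-KontsevichZagierPeriods-8409 · support · rank 9 · closed · proved by Summit.KontsevichZagierPeriods.PeriodConductors.rationalTwoCuts_proof @ 3060bfb18c6f (prover) · by planner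
sources: doi:10.1017/cbo9781316160749, doi:10.1007/bf01393743
[support] cuts of KZ_{2} are {2}-units (card (O1), S = {2}, rational points): c ∈ ℚ with c, 1 − c
both {2}-units ⟺ c ∈ {1/2, 2, −1}; so 1/2 is the only interior rational cut on a {0,1}-walled axis
over ℤ[1/2] (algebraic {2}-unit cuts cos²(π/2^k) of unbounded degree exist — finiteness is per
degree, Evertse). [difficulty: provable-now] -/
@[route_item "route-KontsevichZagierPeriods-PeriodConductors"]
def RationalTwoCuts : Prop :=
  ∀ c : ℚ, (c ≠ 0 ∧ c ≠ 1 ∧ ∀ p : ℕ, p.Prime → p ≠ 2 → padicValRat p c = 0 ∧ padicValRat p (1 - c) = 0) ↔ (c = 1 / 2 ∨ c = 2 ∨ c = -1)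

-- `RationalTwoCuts` holds: proved by `Summit.KontsevichZagierPeriods.PeriodConductors.rationalTwoCuts_proof` @ 3060bfb18c6f (its module imports this route file, so no `_holds` link can be stated here).

/-- item stmt-KontsevichZagierPeriods-8410 · support · rank 9 · closed · proved by Summit.KontsevichZagierPeriods.PeriodConductors.conicCalibration_proof @ 7ab69c04792e (prover) · by planner
sources: KontsevichZagierPeriods2001, Mathlib:MeasureTheory.Measure.addHaar_preimage_linearEquiv
[support] the conic sector of (O2), value level and elementary: if the rational ellipse {ax² + bxy +
cy² < 1} (a, b, c ∈ ℤ, positive definite) has area in ℚ·π then b is even — hence its model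
degenerates to a double line mod 2 (bad reduction at 2): area = 2π/√(4ac−b²) ∈ ℚπ forces 4ac − b² =
d² with d ∈ ℤ, and b odd would need d² ≡ 3 (mod 4). [difficulty: provable-now] -/
@[route_item "route-KontsevichZagierPeriods-PeriodConductors"]
def ConicCalibration : Prop :=
  ∀ a b c : ℤ, 0 < a → b ^ 2 < 4 * a * c → (∃ q : ℚ, MeasureTheory.volume {x : Fin 2 → ℝ | (a : ℝ) * x 0 ^ 2 + (b : ℝ) * x 0 * x 1 + (c : ℝ) * x 1 ^ 2 < 1} = ENNReal.ofReal ((q : ℝ) * Real.pi)) → Even b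

-- `ConicCalibration` holds: proved by `Summit.KontsevichZagierPeriods.PeriodConductors.conicCalibration_proof` @ 7ab69c04792e (its module imports this route file, so no `_holds` link can be stated here).

-- item stmt-KontsevichZagierPeriods-8440 · support · rank 9 · open · by planner — informal only, no Lean statement yet:
--   [support] UnramifiedModularPeriods (card (C2)/U6, Problem-2-type target over D1): the unramified
--   world beyond Tate is level ONE — values of conductor-∅ representations are predicted to lie in
--   Brown's ring of real multiple modular values for SL₂(ℤ) (MZVs and periods of level-1 modular forms;
--   no abelian scheme over ℤ exists (Fontaine 1985), so no elliptic period is unramified, but Δ's are).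
--   Concrete item: Kontsevich–Zagier's own Legendre-family representations of the periods ω_±(Δ) (KZ2001
--   §3.4; 11-dimensional, used by route HeckeMultiplicityOne) have 2 ∈ arrangementConductor (Legendre
--   level 2:

-- earlier Assembly (stmt-KontsevichZagierPeriods-8411, replaced 2026-08-15T16:14:34Z -> stmt-KontsevichZagierPeriods-10400): retired by None — UnimodularKernel → RamifiedReduction → KernelImpliesStatement → KontsevichZagierPeriods
/-- item stmt-KontsevichZagierPeriods-10400 · assembly · rank 1 · closed · proved by Summit.KontsevichZagierPeriods.PeriodConductors.assembly_proof @ 7e78b7a32379 (prover) · by planner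
sources: KontsevichZagierPeriods2001, HuberMullerStachPeriods2017
[assembly] UnimodularKernel → RamifiedReduction → KontsevichZagierPeriods — exactly the type of the
deciding theorem `closes` (rev 2, sorry-free, 10 lines): for r, r' rational with equal values,
KZ.eval ([r] − [r']) = 0; RamifiedReduction gives c' in the ℤ-span of everywhere-good linear cells
with KZ.eval c' = 0 and [r] − [r'] − c' ∈ KZ.relations; UnimodularKernel gives c' ∈ KZ.relations;
add. The kernel→summit step (former hypothesis KernelImpliesStatement, shared item
stmt-KontsevichZagierPeriods-0197) is inlined, so it is no longer an item of this route. -/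
@[route_item "route-KontsevichZagierPeriods-PeriodConductors"]
def Assembly : Prop :=
  UnimodularKernel → RamifiedReduction → KontsevichZagierPeriods

-- `Assembly` holds: proved by `Summit.KontsevichZagierPeriods.PeriodConductors.assembly_proof` @ 7e78b7a32379 (its module imports this route file, so no `_holds` link can be stated here).

/-! D-0027 §2.1 — DECIDING THEOREM (planner-authored via `route open/edit --closes-file`; by planner-rbadge-KontsevichZagierPeriods-PeriodC-500ffdac-g4-0 2026-08-15T16:11:44Z):
its hypotheses are this route's items and its conclusion the sub-problem Statement (glue_lint), and it elaborates with this file. -/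

@[closes "route-KontsevichZagierPeriods-PeriodConductors"] theorem closes (h₁ : UnimodularKernel) (h₂ : RamifiedReduction) : KontsevichZagierPeriods := by
  intro n m r r' _ _ hv
  have h0 : Literature.NumberTheory.Transcendental.KZ.eval
      (Literature.NumberTheory.Transcendental.KZ.of r - Literature.NumberTheory.Transcendental.KZ.of r') = 0 := by
    simp [Literature.NumberTheory.Transcendental.KZ.eval_of, hv]
  obtain ⟨c', hc'mem, hc'eval, hrel⟩ := h₂ _ h0
  have h1 : c' ∈ Literature.NumberTheory.Transcendental.KZ.relations := h₁ c' hc'mem hc'eval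
  have h2 : Literature.NumberTheory.Transcendental.KZ.of r - Literature.NumberTheory.Transcendental.KZ.of r'
      = (Literature.NumberTheory.Transcendental.KZ.of r - Literature.NumberTheory.Transcendental.KZ.of r' - c') + c' :=
    (sub_add_cancel _ _).symm
  show Literature.NumberTheory.Transcendental.KZ.of r - Literature.NumberTheory.Transcendental.KZ.of r'
      ∈ Literature.NumberTheory.Transcendental.KZ.relations
  rw [h2]
  exact add_mem hrel h1

end Summit.KontsevichZagierPeriods.KontsevichZagierPeriods.Theses.PeriodConductors
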